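import Literature.Geometry.Kaehler.ManifoldFormsPullback
import Literature.Geometry.Symplectic.SteinLiouvilleField
import HarnessLib

/-!
# McLean's convexity of a divisor complement: the exhausting function from a defining function

Topic `Literature/Geometry/Symplectic`; proofs file (layer A3) of the fact seat of
`Literature.Geometry.Symplectic.mclean_divisorComplement_convex_four`
(`McleanDivisorComplementConvexFour.lean`; M. McLean, *The growth rate of symplectic homology and
affine varieties*, GAFA 22 (2012), Lemma 5.17).  The printed proof of Lemma 5.17 ends (p. 37 of
arXiv:1011.2542v3, "We now wish to show that we have the structure of a finite type convex
symplectic manifold …") with the following step, isolated here in the tree's `MForm` vocabulary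
and in the abstract form in which the remaining layers consume it:

* the exhausting function is `ν(r)` for a profile `ν` tending to `+∞` at `r = 0`; its Hamiltonian
  field `X_ν` is `ν'`-proportional to the Hamiltonian field of the radius, and
  `X_{θ+df}(d ν(r)) = -X_{ν(r)}(θ + df) > 0` near the divisor because `(θ + df)` is positive on
  the rotation field.

**`exists_exhaustion_of_definingFunction`.**  Let `N` be a compact `C^∞` `4`-manifold, `U ⊆ N`
open, `s` a `2`-form on `N` non-degenerate along `U`, `λ` a `1`-form on `U` with `dλ = s|_U`,
and `ρ : N → ℝ` smooth with `{ρ > 0} = U` (a defining function of the "divisor" `N ∖ U`, so that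
`1/ρ` exhausts `U`).  Suppose that for `x ∈ U` with `ρ x < δ` the form `λ` is positive on the
`s`-dual `X_ρ` of `dρ` (`s(X_ρ, ·) = dρ`).  Then `g = 1/ρ` is smooth on `U`, has compact sublevel
sets, and `dg(X) > 0` on `{g ≥ 2/δ}` for the Liouville vector `X` of `λ` (`dλ(X, ·) = λ`):
indeed `dg(X) = -ρ⁻² dρ(X) = -ρ⁻² s(X_ρ, X) = ρ⁻² s(X, X_ρ) = ρ⁻² λ(X_ρ) > 0`
(McLean's `X_{θ+df}(dg) = -X_g(θ + df)`).

Also two pieces of pointwise linear algebra: antisymmetry on `![u, v]` and the existence of the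
`s`-dual vector of a covector for a non-degenerate `2`-form in finite dimension.

Everything is proved; no definitions, no named facts (D-0026).

## References

* M. McLean, *The growth rate of symplectic homology and affine varieties*, Geom. Funct. Anal. 22
  (2012) 369–442, Lemma 5.17 (end of proof). [Mclean2012]
* K. Cieliebak, Ya. Eliashberg, *From Stein to Weinstein and Back* (2012), §11.1 (Liouville
  fields, convexity). [CieliebakEliashberg2012]
-/

noncomputable section

open scoped Manifold ContDiff Topology
open Set Function Filter

namespace Literature.Geometry.Symplectic

open Literature.Geometry.Kaehler Literature.Geometry.Manifold

/-! ### Pointwise linear algebra -/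

section LinearAlgebra

variable {E : Type*} [NormedAddCommGroup E] [NormedSpace ℝ E]

/-- Antisymmetry of an alternating `2`-form on the pair `![u, v]`: `M(v, u) = -M(u, v)`.
[folklore] -/
theorem alt2_apply_swap (M : E [⋀^Fin 2]→L[ℝ] ℝ) (u v : E) : M ![v, u] = -M ![u, v] := by
  have h := M.map_swap ![u, v] (i := 0) (j := 1) (by decide)
  have hsw : ((![u, v] : Fin 2 → E) ∘ Equiv.swap (0 : Fin 2) 1) = ![v, u] := by
    funext i
    fin_cases i <;> rfl
  rw [hsw] at h
  exact h

variable [FiniteDimensional ℝ E]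

/-- **The `M`-dual vector of a covector.** For a non-degenerate alternating `2`-form `M` on a
finite-dimensional space (`M(v, ·) = 0 ⇒ v = 0`) and a covector `φ` there is `u` with
`M(u, ·) = φ` (the flat map `M^♭` is injective, hence an isomorphism by the dimension count
`dim E^* = dim E`; e.g. the Hamiltonian vector of `dH`, Cieliebak–Eliashberg 2012, §11.1).
[folklore] -/
theorem exists_forall_alt2_apply_eq (M : E [⋀^Fin 2]→L[ℝ] ℝ)
    (hM : ∀ v : E, v ≠ 0 → ∃ w, M ![v, w] ≠ 0) (φ : E →L[ℝ] ℝ) :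
    ∃ u : E, ∀ w, M ![u, w] = φ w := by
  have hinj : Injective (alt2Flat M) := by
    intro v₁ v₂ h
    by_contra hne
    obtain ⟨w, hw⟩ := hM (v₁ - v₂) (sub_ne_zero.2 hne)
    apply hw
    have h' : alt2Flat M (v₁ - v₂) = 0 := by rw [map_sub, h, sub_self]
    simpa only [alt2Flat_apply, zero_apply] using
      congrArg (fun f : E →L[ℝ] ℝ => f w) h'
  obtain ⟨e, he⟩ := exists_continuousLinearEquiv_eq_of_injective hinj
  refine ⟨e.symm φ, fun w => ?_⟩
  rw [← alt2Flat_apply, ← he, ContinuousLinearEquiv.coe_coe, e.apply_symm_apply]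

end LinearAlgebra

/-! ### The exhausting function `1/ρ` -/

section Exhaustion

variable {N : Type*} [TopologicalSpace N] [ChartedSpace (EuclideanSpace ℝ (Fin 4)) N]

/-- **McLean's exhausting function of a divisor complement** (McLean 2012, end of the proof of
Lemma 5.17, abstract form).  `N` a compact `4`-manifold, `U ⊆ N` open, `s` a `2`-form on `N`
non-degenerate at the points of `U`, `λ` a `1`-form on `U` with `dλ = s|_U`, `ρ : N → ℝ` smooth
with `{ρ > 0} = U`, and `δ > 0` such that `λ(X_ρ) > 0` whenever `x ∈ U`, `ρ x < δ` and
`s(X_ρ, ·) = dρ_x`.  Then `g = 1/ρ : U → ℝ` is smooth with compact sublevel sets and, for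
`g x ≥ 2/δ`, `dg_x(X) > 0` for every `X` with `dλ_x(X, ·) = λ_x` (the Liouville vector):
`dg(X) = -ρ⁻² dρ(X) = -ρ⁻² s(X_ρ, X) = ρ⁻² λ(X_ρ) > 0`.  This is exactly the conclusion of
`mclean_divisorComplement_convex_four` for the pair `(λ, g)`.
[cite: Mclean2012, Lemma 5.17 (end of proof)] -/
theorem exists_exhaustion_of_definingFunction [CompactSpace N] {U : TopologicalSpace.Opens N}
    (s : MForm (𝓡 4) N ℝ 2) (lam : MForm (𝓡 4) U ℝ 1) (ρ : N → ℝ) {δ : ℝ}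
    (hnd : ∀ x : U, ∀ v : EuclideanSpace ℝ (Fin 4), v ≠ 0 →
      ∃ w : EuclideanSpace ℝ (Fin 4), s (x : N) ![v, w] ≠ 0)
    (hlam : mextDeriv lam = s.pullback (𝓡 4) (Subtype.val : U → N))
    (hρ : ContMDiff (𝓡 4) 𝓘(ℝ, ℝ) ∞ ρ) (hρU : ∀ x : N, 0 < ρ x ↔ x ∈ U) (hδ : 0 < δ)
    (hpos : ∀ x : U, ρ x < δ → ∀ u : EuclideanSpace ℝ (Fin 4),
      (∀ w : EuclideanSpace ℝ (Fin 4), s (x : N) ![u, w] = mfderiv (𝓡 4) 𝓘(ℝ, ℝ) ρ (x : N) w) →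
      0 < lam x ![u]) :
    ∃ (g : U → ℝ) (C : ℝ), ContMDiff (𝓡 4) 𝓘(ℝ, ℝ) ∞ g ∧ (∀ c : ℝ, IsCompact (g ⁻¹' Iic c)) ∧
      ∀ x : U, C ≤ g x → ∀ v : EuclideanSpace ℝ (Fin 4),
        (∀ w : EuclideanSpace ℝ (Fin 4), mextDeriv lam x ![v, w] = lam x ![w]) →
        (0 : ℝ) < mfderiv (𝓡 4) 𝓘(ℝ, ℝ) g x v := by
  have hρpos : ∀ x : U, 0 < ρ x := fun x => (hρU x).2 x.2
  set g : U → ℝ := fun x => (ρ x)⁻¹ with hg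
  refine ⟨g, 2 / δ, ?_, ?_, ?_⟩
  · -- smoothness of `1/ρ` on `U`
    intro x
    have h1 : ContMDiffAt (𝓡 4) 𝓘(ℝ, ℝ) ∞ (ρ ∘ (Subtype.val : U → N)) x :=
      ContMDiffAt.comp x (hρ (x : N)) (contMDiff_subtype_val x)
    exact ContDiffAt.comp_contMDiffAt (f := ρ ∘ (Subtype.val : U → N)) (x := x)
      (contDiffAt_inv ℝ (hρpos x).ne') h1
  · -- compact sublevel sets
    intro c
    rcases le_or_gt c 0 with hc | hc
    · have he : g ⁻¹' Iic c = ∅ := by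
        ext x
        simp only [mem_preimage, mem_Iic, mem_empty_iff_false, iff_false, not_le]
        exact hc.trans_lt (inv_pos.2 (hρpos x))
      rw [he]
      exact isCompact_empty
    · have hK : IsCompact {y : N | c⁻¹ ≤ ρ y} :=
        (isClosed_le continuous_const hρ.continuous).isCompact
      have hKU : {y : N | c⁻¹ ≤ ρ y} ⊆ range (Subtype.val : U → N) := by
        intro y hy
        exact ⟨⟨y, (hρU y).1 ((inv_pos.2 hc).trans_le hy)⟩, rfl⟩
      have hset : g ⁻¹' Iic c = (Subtype.val : U → N) ⁻¹' {y : N | c⁻¹ ≤ ρ y} := by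
        ext x
        simp only [mem_preimage, mem_Iic, mem_setOf_eq, hg]
        exact inv_le_comm₀ (hρpos x) hc
      rw [hset]
      exact Topology.IsInducing.subtypeVal.isCompact_preimage' hK hKU
  · -- `dg(X) = ρ⁻² λ(X_ρ) > 0`
    intro x hx v hv
    have hρx : ρ x < δ := by
      have h2 : (2 / δ : ℝ) ≤ (ρ x)⁻¹ := hx
      rw [le_inv_comm₀ (by positivity) (hρpos x)] at h2
      calc ρ x ≤ (2 / δ)⁻¹ := h2
        _ = δ / 2 := by rw [inv_div]
        _ < δ := by linarith
    -- the Liouville identity read through `dλ = s|_U`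
    have hv' : ∀ w : EuclideanSpace ℝ (Fin 4), s (x : N) ![v, w] = lam x ![w] :=
        fun w => by
      have h := hv w
      rw [hlam, MForm.pullback_subtypeVal_apply] at h
      exact h
    -- the `s`-dual `u = X_ρ` of `dρ` at `x`
    obtain ⟨u, hu⟩ := exists_forall_alt2_apply_eq (E := EuclideanSpace ℝ (Fin 4)) (s (x : N))
      (hnd x) (mfderiv (𝓡 4) 𝓘(ℝ, ℝ) ρ (x : N))
    have hlampos : 0 < lam x ![u] := hpos x hρx u hu
    have hdρv : mfderiv (𝓡 4) 𝓘(ℝ, ℝ) ρ (x : N) v = -lam x ![u] := by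
      have h1 : s (x : N) ![u, v] = mfderiv (𝓡 4) 𝓘(ℝ, ℝ) ρ (x : N) v := hu v
      have h2 : s (x : N) ![v, u] = lam x ![u] := hv' u
      have h3 : s (x : N) ![v, u] = -s (x : N) ![u, v] := alt2_apply_swap (s (x : N)) u v
      rw [← h1, ← h2, h3, neg_neg]
    -- the differential of `g = inv ∘ ρ ∘ val`
    have hval := OpenSubmanifold.hasMFDerivAt_subtype_val (I := 𝓡 4) x
    have hρd : HasMFDerivAt (𝓡 4) 𝓘(ℝ, ℝ) ρ (x : N) (mfderiv (𝓡 4) 𝓘(ℝ, ℝ) ρ (x : N)) :=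
      ((hρ (x : N)).mdifferentiableAt (by simp)).hasMFDerivAt
    have hcomp := hρd.comp x hval
    have hinv : HasMFDerivAt 𝓘(ℝ, ℝ) 𝓘(ℝ, ℝ) (fun t : ℝ => t⁻¹) (ρ (x : N))
        (ContinuousLinearMap.smulRight (1 : ℝ →L[ℝ] ℝ) (-(ρ (x : N) ^ 2)⁻¹)) :=
      (hasDerivAt_inv (hρpos x).ne').hasFDerivAt.hasMFDerivAt
    have hgd : HasMFDerivAt (𝓡 4) 𝓘(ℝ, ℝ) g x
        ((ContinuousLinearMap.smulRight (1 : ℝ →L[ℝ] ℝ) (-(ρ (x : N) ^ 2)⁻¹)).comp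
          ((mfderiv (𝓡 4) 𝓘(ℝ, ℝ) ρ (x : N)).comp
            (ContinuousLinearMap.id ℝ (EuclideanSpace ℝ (Fin 4))))) :=
      hinv.comp x hcomp
    have key : mfderiv (𝓡 4) 𝓘(ℝ, ℝ) g x v = lam x ![u] * (ρ (x : N) ^ 2)⁻¹ := by
      rw [hgd.mfderiv]
      change @id ℝ (mfderiv (𝓡 4) 𝓘(ℝ, ℝ) ρ (x : N) v) * (-(ρ (x : N) ^ 2)⁻¹) = _
      rw [hdρv, id_eq, neg_mul_neg]
    rw [key]
    exact mul_pos hlampos (inv_pos.2 (pow_pos (hρpos x) 2))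

end Exhaustion

end Literature.Geometry.Symplectic
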